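import Literature.Probability.Moments.EfronStein

/-!
# The Efron–Stein inequality — proof (discharge of the named fact)

`theorem EfronSteinInequality_holds : EfronSteinInequality` for the named fact vendored in
`Literature/Probability/Moments/EfronStein.lean` (Boucheron–Bousquet–Lugosi 2004, §2 Theorem 5;
Efron–Stein 1981, Steele 1986). This file only adds theorems (no new notions, no new facts).

## Proof

We follow the architecture of the printed proof (Boucheron–Bousquet–Lugosi 2004, §2, proofs of
Theorems 4 and 5): the variance is decomposed along a chain of coordinate sets
`∅ = S₀ ⊂ S₁ ⊂ ⋯ ⊂ Sₙ = univ` (the Doob martingale decomposition `Var Z = Σ E Vᵢ²`), and the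
increment belonging to coordinate `i` is bounded by the resampling term `½ E[(Z − Zᵢ')²]`.
Mathlib has no ready-made identification of conditional expectations on a product space with
coordinate integrals, so instead of conditional expectations we work on the *doubled* product
space `Π i, (Ω i × Ω i)` with law `⨂ᵢ (μᵢ ⊗ μᵢ)`, carrying two independent copies `X = ((ω i).1)ᵢ`
and `X' = ((ω i).2)ᵢ`; writing `G_S = g (X with the coordinates in S taken from X')`, every step
is an identity of integrals under a measure-preserving coordinate swap
(`MeasureTheory.measurePreserving_pi`):

* `Var g = E[G_∅ (G_∅ − G_univ)]` (independence of the two copies) and, telescoping along the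
  chain by a `Finset` induction, `E[G_∅ (G_∅ − G_univ)] = Σ E[G_∅ (G_S − G_{S ∪ {i}})]`; here
  `E[G_∅ (G_S − G_{S∪{i}})] = E V²` for the martingale difference
  `V = E[Z | X_j, j ∉ S] − E[Z | X_j, j ∉ S ∪ {i}]` of the printed proof;
* swapping the two copies of coordinate `i` gives
  `2 E[G_∅ (G_S − G_{S∪{i}})] = E[(G_∅ − G_{{i}})(G_S − G_{S∪{i}})] ≤ ½ E[(G_∅ − G_{{i}})²] +
  ½ E[(G_S − G_{S∪{i}})²]`, and swapping the copies of all coordinates in `S` identifies the last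
  two expectations; this replaces Jensen's inequality in the printed bound
  `E Vᵢ² ≤ E[(Z − Eᵢ Z)²] = ½ E[(Z − Zᵢ')²]`;
* finally `E[(G_∅ − G_{{i}})²] = ∫∫ (g x − g (update x i y))² dμᵢ(y) dπ(x)` by Fubini.

The maps "read with the coordinates in `S` taken from the second copy" (`rd S`) and "swap the two
copies on `S`" (`fl S`) are passed to the auxiliary lemmas as variables together with their
pointwise descriptions `hrd`, `hfl` (no auxiliary declarations are introduced).

## References

* S. Boucheron, O. Bousquet, G. Lugosi, *Concentration Inequalities*, in: Advanced Lectures on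
  Machine Learning, LNCS 3176, Springer 2004, pp. 208–240, §2 Theorems 4–5 with proofs
  [BoucheronBousquetLugosi2004] (read: the pages of §2 were materialised for this discharge).
* B. Efron, C. Stein, Ann. Statist. 9 (1981) 586–596 [EfronStein1981]; J. M. Steele, Ann.
  Statist. 14 (1986) 753–758 [Steele1986] (original sources, as attributed in BBL04). -/

noncomputable section

open MeasureTheory ProbabilityTheory

namespace Literature.Probability.Moments

namespace EfronStein

open Function MeasureTheory.Measure

/-- Transport of a Bochner integral along a measure-preserving map, for an a.e.-strongly
measurable real integrand (no measurable-embedding hypothesis is needed). [folklore] -/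
theorem integral_comp_eq {α β : Type*} [MeasurableSpace α] [MeasurableSpace β]
    {μa : Measure α} {μb : Measure β} {f : α → β} (hf : MeasurePreserving f μa μb)
    {φ : β → ℝ} (hφ : AEStronglyMeasurable φ μb) :
    ∫ x, φ (f x) ∂μa = ∫ y, φ y ∂μb := by
  rw [← hf.map_eq] at hφ
  rw [← integral_map hf.measurable.aemeasurable hφ, hf.map_eq]

/-- The "unzip" map `ω ↦ (((ω i).1)ᵢ, ((ω i).2)ᵢ)` pushes `⨂ᵢ (μᵢ ⊗ νᵢ)` forward to
`(⨂ᵢ μᵢ) ⊗ (⨂ᵢ νᵢ)`; this is the dependent-type version of Mathlib's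
`MeasureTheory.measurePreserving_arrowProdEquivProdArrow`, with the same proof. [folklore] -/
theorem measurePreserving_unzip {ι : Type*} [Fintype ι] {Ω Ω' : ι → Type*}
    [∀ i, MeasurableSpace (Ω i)] [∀ i, MeasurableSpace (Ω' i)]
    (μ : ∀ i, Measure (Ω i)) (ν : ∀ i, Measure (Ω' i)) [∀ i, SigmaFinite (μ i)]
    [∀ i, SigmaFinite (ν i)] :
    MeasurePreserving (fun ω : (∀ i, Ω i × Ω' i) => ((fun i => (ω i).1), (fun i => (ω i).2)))
      (Measure.pi fun i => (μ i).prod (ν i)) ((Measure.pi μ).prod (Measure.pi ν)) := by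
  have hm : Measurable (fun ω : (∀ i, Ω i × Ω' i) => ((fun i => (ω i).1), (fun i => (ω i).2))) :=
    (measurable_pi_lambda _ fun i => measurable_fst.comp (measurable_pi_apply i)).prodMk
      (measurable_pi_lambda _ fun i => measurable_snd.comp (measurable_pi_apply i))
  refine ⟨hm, ?_⟩
  refine (FiniteSpanningSetsIn.ext ?_ (isPiSystem_pi.prod isPiSystem_pi)
    ((FiniteSpanningSetsIn.pi fun i => (μ i).toFiniteSpanningSetsIn).prod
      (FiniteSpanningSetsIn.pi fun i => (ν i).toFiniteSpanningSetsIn)) ?_).symm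
  · refine (generateFrom_eq_prod generateFrom_pi generateFrom_pi ?_ ?_).symm
    · exact (FiniteSpanningSetsIn.pi fun i => (μ i).toFiniteSpanningSetsIn).isCountablySpanning
    · exact (FiniteSpanningSetsIn.pi fun i => (ν i).toFiniteSpanningSetsIn).isCountablySpanning
  · rintro _ ⟨_, ⟨s, hs, rfl⟩, _, ⟨t, ht, rfl⟩, rfl⟩
    have hst : MeasurableSet (Set.univ.pi s ×ˢ Set.univ.pi t) :=
      (MeasurableSet.univ_pi fun i => Set.mem_univ_pi.1 hs i).prod
        (MeasurableSet.univ_pi fun i => Set.mem_univ_pi.1 ht i)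
    rw [map_apply hm hst,
      show (fun ω : (∀ i, Ω i × Ω' i) => ((fun i => (ω i).1), (fun i => (ω i).2))) ⁻¹'
          (Set.univ.pi s ×ˢ Set.univ.pi t) = Set.univ.pi fun i => s i ×ˢ t i by
        ext; simp [Set.mem_pi, forall_and]]
    simp_rw [pi_pi, prod_prod, pi_pi, Finset.prod_mul_distrib]

universe u v

variable {ι : Type u} {Ω : ι → Type v}

/-- Swapping the two copies of the coordinates in `S` preserves `⨂ᵢ (μᵢ ⊗ μᵢ)`. [folklore] -/
theorem measurePreserving_flip [Fintype ι] [DecidableEq ι] [∀ i, MeasurableSpace (Ω i)]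
    (μ : ∀ i, Measure (Ω i)) [∀ i, SigmaFinite (μ i)]
    {fl : Finset ι → (∀ i, Ω i × Ω i) → ∀ i, Ω i × Ω i}
    (hfl : ∀ S ω j, fl S ω j = if j ∈ S then (ω j).swap else ω j) (S : Finset ι) :
    MeasurePreserving (fl S) (Measure.pi fun i => (μ i).prod (μ i))
      (Measure.pi fun i => (μ i).prod (μ i)) := by
  have h : ∀ j, MeasurePreserving (fun p : Ω j × Ω j => if j ∈ S then p.swap else p)
      ((μ j).prod (μ j)) ((μ j).prod (μ j)) := fun j => by
    by_cases hj : j ∈ S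
    · simp only [if_pos hj]
      exact measurePreserving_swap
    · simp only [if_neg hj]
      exact MeasurePreserving.id _
  have hfl' : fl S = fun ω j => (fun p : Ω j × Ω j => if j ∈ S then p.swap else p) (ω j) :=
    funext fun ω => funext fun j => hfl S ω j
  rw [hfl']
  exact measurePreserving_pi _ _ h

/-- Reading the first copy, with the coordinates in `S` taken from the second copy, is
measure-preserving from the doubled space `⨂ᵢ (μᵢ ⊗ μᵢ)` to `⨂ᵢ μᵢ`. [folklore] -/
theorem measurePreserving_read [Fintype ι] [DecidableEq ι] [∀ i, MeasurableSpace (Ω i)]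
    (μ : ∀ i, Measure (Ω i)) [∀ i, IsProbabilityMeasure (μ i)]
    {rd : Finset ι → (∀ i, Ω i × Ω i) → ∀ i, Ω i}
    {fl : Finset ι → (∀ i, Ω i × Ω i) → ∀ i, Ω i × Ω i}
    (hrd : ∀ S ω j, rd S ω j = if j ∈ S then (ω j).2 else (ω j).1)
    (hfl : ∀ S ω j, fl S ω j = if j ∈ S then (ω j).swap else ω j) (S : Finset ι) :
    MeasurePreserving (rd S) (Measure.pi fun i => (μ i).prod (μ i)) (Measure.pi μ) := by
  have h1 : MeasurePreserving (fun (ω : ∀ i, Ω i × Ω i) j => (ω j).1)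
      (Measure.pi fun i => (μ i).prod (μ i)) (Measure.pi μ) :=
    measurePreserving_pi _ _ fun j => measurePreserving_fst
  have h2 : rd S = (fun (ω : ∀ i, Ω i × Ω i) j => (ω j).1) ∘ fl S := by
    funext ω j
    simp only [Function.comp_apply, hrd, hfl]
    split_ifs <;> rfl
  rw [h2]
  exact h1.comp (measurePreserving_flip μ hfl S)

/-- Reading after swapping: `rd T ∘ fl S = rd U` whenever `U` is the symmetric difference of `T`
and `S`. [folklore] -/
theorem read_flip [DecidableEq ι]
    {rd : Finset ι → (∀ i, Ω i × Ω i) → ∀ i, Ω i}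
    {fl : Finset ι → (∀ i, Ω i × Ω i) → ∀ i, Ω i × Ω i}
    (hrd : ∀ S ω j, rd S ω j = if j ∈ S then (ω j).2 else (ω j).1)
    (hfl : ∀ S ω j, fl S ω j = if j ∈ S then (ω j).swap else ω j) {T S U : Finset ι}
    (hU : ∀ j, j ∈ U ↔ ((j ∈ T ∧ j ∉ S) ∨ (j ∉ T ∧ j ∈ S))) (ω : ∀ i, Ω i × Ω i) :
    rd T (fl S ω) = rd U ω := by
  funext j
  rw [hrd, hrd, hfl]
  by_cases hT : j ∈ T <;> by_cases hS : j ∈ S <;> simp [hT, hS, hU]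

/-- `rd ∅` is the first copy. [folklore] -/
theorem read_empty [DecidableEq ι] {rd : Finset ι → (∀ i, Ω i × Ω i) → ∀ i, Ω i}
    (hrd : ∀ S ω j, rd S ω j = if j ∈ S then (ω j).2 else (ω j).1) (ω : ∀ i, Ω i × Ω i) :
    rd ∅ ω = fun j => (ω j).1 :=
  funext fun j => by simp [hrd]

/-- `rd univ` is the second copy. [folklore] -/
theorem read_univ [Fintype ι] [DecidableEq ι] {rd : Finset ι → (∀ i, Ω i × Ω i) → ∀ i, Ω i}
    (hrd : ∀ S ω j, rd S ω j = if j ∈ S then (ω j).2 else (ω j).1) (ω : ∀ i, Ω i × Ω i) :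
    rd Finset.univ ω = fun j => (ω j).2 :=
  funext fun j => by simp [hrd]

/-- `rd {i}` replaces exactly the `i`-th coordinate of the first copy by that of the second
copy. [folklore] -/
theorem read_singleton [DecidableEq ι] {rd : Finset ι → (∀ i, Ω i × Ω i) → ∀ i, Ω i}
    (hrd : ∀ S ω j, rd S ω j = if j ∈ S then (ω j).2 else (ω j).1) (i : ι)
    (ω : ∀ i, Ω i × Ω i) :
    rd {i} ω = Function.update (fun j => (ω j).1) i (ω i).2 := by
  funext j
  by_cases hj : j = i
  · subst hj
    simp [hrd]
  · rw [Function.update_of_ne hj, hrd]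
    simp [hj]

/-- Each `g ∘ rd S` is square-integrable on the doubled space when `g` is square-integrable for
`⨂ᵢ μᵢ`. [folklore] -/
theorem memLp_read [Fintype ι] [DecidableEq ι] [∀ i, MeasurableSpace (Ω i)]
    (μ : ∀ i, Measure (Ω i)) [∀ i, IsProbabilityMeasure (μ i)]
    {rd : Finset ι → (∀ i, Ω i × Ω i) → ∀ i, Ω i}
    {fl : Finset ι → (∀ i, Ω i × Ω i) → ∀ i, Ω i × Ω i}
    (hrd : ∀ S ω j, rd S ω j = if j ∈ S then (ω j).2 else (ω j).1)
    (hfl : ∀ S ω j, fl S ω j = if j ∈ S then (ω j).swap else ω j)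
    {g : (∀ i, Ω i) → ℝ} (hg : MemLp g 2 (Measure.pi μ)) (S : Finset ι) :
    MemLp (fun ω => g (rd S ω)) 2 (Measure.pi fun i => (μ i).prod (μ i)) :=
  hg.comp_measurePreserving (measurePreserving_read μ hrd hfl S)

/-- The one-coordinate step (the bound `E Vᵢ² ≤ ½ E[(Z − Zᵢ')²]` of the printed proof, in
doubled form): for `i ∉ S`, `E[G_∅ (G_S − G_{S ∪ {i}})] ≤ ½ E[(G_∅ − G_{{i}})²]`. [folklore] -/
theorem integral_step_le [Fintype ι] [DecidableEq ι] [∀ i, MeasurableSpace (Ω i)]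
    (μ : ∀ i, Measure (Ω i)) [∀ i, IsProbabilityMeasure (μ i)]
    {rd : Finset ι → (∀ i, Ω i × Ω i) → ∀ i, Ω i}
    {fl : Finset ι → (∀ i, Ω i × Ω i) → ∀ i, Ω i × Ω i}
    (hrd : ∀ S ω j, rd S ω j = if j ∈ S then (ω j).2 else (ω j).1)
    (hfl : ∀ S ω j, fl S ω j = if j ∈ S then (ω j).swap else ω j)
    {g : (∀ i, Ω i) → ℝ} (hgm : Measurable g) (hg : MemLp g 2 (Measure.pi μ))
    (S : Finset ι) {i : ι} (hi : i ∉ S) :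
    ∫ ω, g (rd ∅ ω) * (g (rd S ω) - g (rd (insert i S) ω)) ∂Measure.pi (fun i => (μ i).prod (μ i))
      ≤ (1 / 2 : ℝ) *
        ∫ ω, (g (rd ∅ ω) - g (rd {i} ω)) ^ 2 ∂Measure.pi (fun i => (μ i).prod (μ i)) := by
  have hgr : ∀ T, Measurable (fun ω => g (rd T ω)) := fun T =>
    hgm.comp (measurePreserving_read μ hrd hfl T).measurable
  have hL : ∀ T, MemLp (fun ω => g (rd T ω)) 2 (Measure.pi fun i => (μ i).prod (μ i)) :=
    fun T => memLp_read μ hrd hfl hg T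
  -- the five symmetric differences that occur
  have e1 : ∀ j, j ∈ (∅ : Finset ι) ↔
      ((j ∈ ({i} : Finset ι) ∧ j ∉ ({i} : Finset ι)) ∨ (j ∉ ({i} : Finset ι) ∧ j ∈ ({i} : Finset ι))) := by
    intro j; simp
  have e2 : ∀ j, j ∈ S ↔
      ((j ∈ insert i S ∧ j ∉ ({i} : Finset ι)) ∨ (j ∉ insert i S ∧ j ∈ ({i} : Finset ι))) := by
    intro j
    by_cases h : j = i
    · subst h; simp [hi]
    · simp [h]
  have e3 : ∀ j, j ∈ insert i S ↔
      ((j ∈ S ∧ j ∉ ({i} : Finset ι)) ∨ (j ∉ S ∧ j ∈ ({i} : Finset ι))) := by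
    intro j
    by_cases h : j = i
    · subst h; simp [hi]
    · simp [h]
  have e4 : ∀ j, j ∈ S ↔ ((j ∈ (∅ : Finset ι) ∧ j ∉ S) ∨ (j ∉ (∅ : Finset ι) ∧ j ∈ S)) := by
    intro j; simp
  have e5 : ∀ j, j ∈ insert i S ↔
      ((j ∈ ({i} : Finset ι) ∧ j ∉ S) ∨ (j ∉ ({i} : Finset ι) ∧ j ∈ S)) := by
    intro j
    by_cases h : j = i
    · subst h; simp [hi]
    · simp [h]
  -- (1) swapping the two copies of coordinate `i`
  have h1 : ∫ ω, g (rd ∅ ω) * (g (rd S ω) - g (rd (insert i S) ω))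
        ∂Measure.pi (fun i => (μ i).prod (μ i))
      = ∫ ω, g (rd {i} ω) * (g (rd (insert i S) ω) - g (rd S ω))
        ∂Measure.pi (fun i => (μ i).prod (μ i)) := by
    have hφ : AEStronglyMeasurable (fun ω => g (rd {i} ω) * (g (rd (insert i S) ω) - g (rd S ω)))
        (Measure.pi fun i => (μ i).prod (μ i)) :=
      ((hgr {i}).mul ((hgr (insert i S)).sub (hgr S))).aestronglyMeasurable
    rw [← integral_comp_eq (measurePreserving_flip μ hfl {i}) hφ]
    refine integral_congr_ae (ae_of_all _ fun ω => ?_)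
    dsimp only
    rw [read_flip hrd hfl e1 ω, read_flip hrd hfl e2 ω, read_flip hrd hfl e3 ω]
  -- (2) swapping the two copies of all coordinates in `S`
  have h2 : ∫ ω, (g (rd S ω) - g (rd (insert i S) ω)) ^ 2 ∂Measure.pi (fun i => (μ i).prod (μ i))
      = ∫ ω, (g (rd ∅ ω) - g (rd {i} ω)) ^ 2 ∂Measure.pi (fun i => (μ i).prod (μ i)) := by
    have hφ : AEStronglyMeasurable (fun ω => (g (rd ∅ ω) - g (rd {i} ω)) ^ 2)
        (Measure.pi fun i => (μ i).prod (μ i)) :=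
      (((hgr ∅).sub (hgr {i})).pow_const 2).aestronglyMeasurable
    rw [← integral_comp_eq (measurePreserving_flip μ hfl S) hφ]
    refine integral_congr_ae (ae_of_all _ fun ω => ?_)
    dsimp only
    rw [read_flip hrd hfl e4 ω, read_flip hrd hfl e5 ω]
  -- (3) add the two expressions of the left-hand side and use `2ab ≤ a² + b²` pointwise
  have hI1 : Integrable (fun ω => g (rd ∅ ω) * (g (rd S ω) - g (rd (insert i S) ω)))
      (Measure.pi fun i => (μ i).prod (μ i)) := (hL ∅).integrable_mul ((hL S).sub (hL _))
  have hI2 : Integrable (fun ω => g (rd {i} ω) * (g (rd (insert i S) ω) - g (rd S ω)))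
      (Measure.pi fun i => (μ i).prod (μ i)) := (hL {i}).integrable_mul ((hL _).sub (hL S))
  have hI3 : Integrable (fun ω => (g (rd ∅ ω) - g (rd {i} ω)) ^ 2)
      (Measure.pi fun i => (μ i).prod (μ i)) := ((hL ∅).sub (hL {i})).integrable_sq
  have hI4 : Integrable (fun ω => (g (rd S ω) - g (rd (insert i S) ω)) ^ 2)
      (Measure.pi fun i => (μ i).prod (μ i)) := ((hL S).sub (hL _)).integrable_sq
  have h3 : ∫ ω, g (rd ∅ ω) * (g (rd S ω) - g (rd (insert i S) ω))
        ∂Measure.pi (fun i => (μ i).prod (μ i))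
      + ∫ ω, g (rd {i} ω) * (g (rd (insert i S) ω) - g (rd S ω))
        ∂Measure.pi (fun i => (μ i).prod (μ i))
      ≤ (1 / 2 : ℝ) * (∫ ω, (g (rd ∅ ω) - g (rd {i} ω)) ^ 2 ∂Measure.pi (fun i => (μ i).prod (μ i))
        + ∫ ω, (g (rd S ω) - g (rd (insert i S) ω)) ^ 2 ∂Measure.pi (fun i => (μ i).prod (μ i))) := by
    rw [← integral_add hI1 hI2, ← integral_add hI3 hI4, ← integral_const_mul]
    refine integral_mono (hI1.add hI2) ((hI3.add hI4).const_mul _) fun ω => ?_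
    dsimp only
    nlinarith [sq_nonneg (g (rd ∅ ω) - g (rd {i} ω) - (g (rd S ω) - g (rd (insert i S) ω)))]
  linarith [h1, h2, h3]

/-- Telescoping along a chain of coordinate sets (the decomposition `Var Z = Σ E Vᵢ²` of the
printed proof, as a `Finset` induction): `E[G_∅ (G_∅ − G_S)] ≤ ½ Σ_{i ∈ S} E[(G_∅ − G_{{i}})²]`.
[folklore] -/
theorem integral_le_sum [Fintype ι] [DecidableEq ι] [∀ i, MeasurableSpace (Ω i)]
    (μ : ∀ i, Measure (Ω i)) [∀ i, IsProbabilityMeasure (μ i)]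
    {rd : Finset ι → (∀ i, Ω i × Ω i) → ∀ i, Ω i}
    {fl : Finset ι → (∀ i, Ω i × Ω i) → ∀ i, Ω i × Ω i}
    (hrd : ∀ S ω j, rd S ω j = if j ∈ S then (ω j).2 else (ω j).1)
    (hfl : ∀ S ω j, fl S ω j = if j ∈ S then (ω j).swap else ω j)
    {g : (∀ i, Ω i) → ℝ} (hgm : Measurable g) (hg : MemLp g 2 (Measure.pi μ)) (S : Finset ι) :
    ∫ ω, g (rd ∅ ω) * (g (rd ∅ ω) - g (rd S ω)) ∂Measure.pi (fun i => (μ i).prod (μ i))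
      ≤ (1 / 2 : ℝ) * ∑ i ∈ S,
        ∫ ω, (g (rd ∅ ω) - g (rd {i} ω)) ^ 2 ∂Measure.pi (fun i => (μ i).prod (μ i)) := by
  induction S using Finset.induction_on with
  | empty => simp
  | insert i S hi ih =>
    have hL : ∀ T, MemLp (fun ω => g (rd T ω)) 2 (Measure.pi fun i => (μ i).prod (μ i)) :=
      fun T => memLp_read μ hrd hfl hg T
    have hI1 : Integrable (fun ω => g (rd ∅ ω) * (g (rd ∅ ω) - g (rd S ω)))
        (Measure.pi fun i => (μ i).prod (μ i)) := (hL ∅).integrable_mul ((hL ∅).sub (hL S))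
    have hI2 : Integrable (fun ω => g (rd ∅ ω) * (g (rd S ω) - g (rd (insert i S) ω)))
        (Measure.pi fun i => (μ i).prod (μ i)) := (hL ∅).integrable_mul ((hL S).sub (hL _))
    have hsplit : ∫ ω, g (rd ∅ ω) * (g (rd ∅ ω) - g (rd (insert i S) ω))
          ∂Measure.pi (fun i => (μ i).prod (μ i))
        = ∫ ω, g (rd ∅ ω) * (g (rd ∅ ω) - g (rd S ω)) ∂Measure.pi (fun i => (μ i).prod (μ i))
          + ∫ ω, g (rd ∅ ω) * (g (rd S ω) - g (rd (insert i S) ω))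
            ∂Measure.pi (fun i => (μ i).prod (μ i)) := by
      rw [← integral_add hI1 hI2]
      refine integral_congr_ae (ae_of_all _ fun ω => ?_)
      dsimp only
      ring
    rw [hsplit, Finset.sum_insert hi, mul_add]
    have hstep := integral_step_le μ hrd hfl hgm hg S hi
    linarith

/-- `Var g = E[G_∅ (G_∅ − G_univ)]` on the doubled space (independence of the two copies).
[folklore] -/
theorem variance_eq_integral [Fintype ι] [DecidableEq ι] [∀ i, MeasurableSpace (Ω i)]
    (μ : ∀ i, Measure (Ω i)) [∀ i, IsProbabilityMeasure (μ i)]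
    {rd : Finset ι → (∀ i, Ω i × Ω i) → ∀ i, Ω i}
    {fl : Finset ι → (∀ i, Ω i × Ω i) → ∀ i, Ω i × Ω i}
    (hrd : ∀ S ω j, rd S ω j = if j ∈ S then (ω j).2 else (ω j).1)
    (hfl : ∀ S ω j, fl S ω j = if j ∈ S then (ω j).swap else ω j)
    {g : (∀ i, Ω i) → ℝ} (hgm : Measurable g) (hg : MemLp g 2 (Measure.pi μ)) :
    variance g (Measure.pi μ)
      = ∫ ω, g (rd ∅ ω) * (g (rd ∅ ω) - g (rd Finset.univ ω))
          ∂Measure.pi (fun i => (μ i).prod (μ i)) := by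
  have hL : ∀ T, MemLp (fun ω => g (rd T ω)) 2 (Measure.pi fun i => (μ i).prod (μ i)) :=
    fun T => memLp_read μ hrd hfl hg T
  have h1 : ∫ x, g x ^ 2 ∂Measure.pi μ
      = ∫ ω, g (rd ∅ ω) ^ 2 ∂Measure.pi (fun i => (μ i).prod (μ i)) := by
    have hφ : AEStronglyMeasurable (fun x => g x ^ 2) (Measure.pi μ) :=
      (hgm.pow_const 2).aestronglyMeasurable
    rw [← integral_comp_eq (measurePreserving_read μ hrd hfl ∅) hφ]
  have hm2 : Measurable (fun z : (∀ i, Ω i) × (∀ i, Ω i) => g z.1 * g z.2) :=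
    (hgm.comp measurable_fst).mul (hgm.comp measurable_snd)
  have h2 : (∫ x, g x ∂Measure.pi μ) ^ 2
      = ∫ ω, g (rd ∅ ω) * g (rd Finset.univ ω) ∂Measure.pi (fun i => (μ i).prod (μ i)) := by
    rw [sq, ← integral_prod_mul (μ := Measure.pi μ) (ν := Measure.pi μ) g g,
      ← integral_comp_eq (measurePreserving_unzip μ μ) hm2.aestronglyMeasurable]
    refine integral_congr_ae (ae_of_all _ fun ω => ?_)
    dsimp only
    rw [read_empty hrd ω, read_univ hrd ω]
  have hI1 : Integrable (fun ω => g (rd ∅ ω) ^ 2) (Measure.pi fun i => (μ i).prod (μ i)) :=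
    (hL ∅).integrable_sq
  have hI2 : Integrable (fun ω => g (rd ∅ ω) * g (rd Finset.univ ω))
      (Measure.pi fun i => (μ i).prod (μ i)) := (hL ∅).integrable_mul (hL _)
  rw [variance_eq_sub hg]
  simp only [Pi.pow_apply]
  rw [h1, h2, ← integral_sub hI1 hI2]
  refine integral_congr_ae (ae_of_all _ fun ω => ?_)
  dsimp only
  ring

/-- Fubini: `E[(G_∅ − G_{{i}})²] = ∫ (∫ (g x − g (update x i y))² dμᵢ(y)) dπ(x)`. [folklore] -/
theorem integral_sq_sub_eq [Fintype ι] [DecidableEq ι] [∀ i, MeasurableSpace (Ω i)]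
    (μ : ∀ i, Measure (Ω i)) [∀ i, IsProbabilityMeasure (μ i)]
    {rd : Finset ι → (∀ i, Ω i × Ω i) → ∀ i, Ω i}
    {fl : Finset ι → (∀ i, Ω i × Ω i) → ∀ i, Ω i × Ω i}
    (hrd : ∀ S ω j, rd S ω j = if j ∈ S then (ω j).2 else (ω j).1)
    (hfl : ∀ S ω j, fl S ω j = if j ∈ S then (ω j).swap else ω j)
    {g : (∀ i, Ω i) → ℝ} (hgm : Measurable g) (hg : MemLp g 2 (Measure.pi μ)) (i : ι) :
    ∫ ω, (g (rd ∅ ω) - g (rd {i} ω)) ^ 2 ∂Measure.pi (fun i => (μ i).prod (μ i))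
      = ∫ x, (∫ y, (g x - g (Function.update x i y)) ^ 2 ∂μ i) ∂Measure.pi μ := by
  have hL : ∀ T, MemLp (fun ω => g (rd T ω)) 2 (Measure.pi fun i => (μ i).prod (μ i)) :=
    fun T => memLp_read μ hrd hfl hg T
  have hU : Measurable (fun z : (∀ i, Ω i) × (∀ i, Ω i) => Function.update z.1 i (z.2 i)) :=
    measurable_update'.comp (measurable_fst.prodMk ((measurable_pi_apply i).comp measurable_snd))
  have hH : Measurable
      (fun z : (∀ i, Ω i) × (∀ i, Ω i) => (g z.1 - g (Function.update z.1 i (z.2 i))) ^ 2) :=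
    ((hgm.comp measurable_fst).sub (hgm.comp hU)).pow_const 2
  have hpt : ∀ ω : ∀ i, Ω i × Ω i, (g (rd ∅ ω) - g (rd {i} ω)) ^ 2
      = (g (fun j => (ω j).1) - g (Function.update (fun j => (ω j).1) i (ω i).2)) ^ 2 := by
    intro ω
    rw [read_singleton hrd i ω, read_empty hrd ω]
  have h1 : ∫ ω, (g (rd ∅ ω) - g (rd {i} ω)) ^ 2 ∂Measure.pi (fun i => (μ i).prod (μ i))
      = ∫ z, (g z.1 - g (Function.update z.1 i (z.2 i))) ^ 2
          ∂(Measure.pi μ).prod (Measure.pi μ) := by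
    rw [← integral_comp_eq (measurePreserving_unzip μ μ) hH.aestronglyMeasurable]
    exact integral_congr_ae (ae_of_all _ fun ω => hpt ω)
  have hint : Integrable
      (fun z : (∀ i, Ω i) × (∀ i, Ω i) => (g z.1 - g (Function.update z.1 i (z.2 i))) ^ 2)
      ((Measure.pi μ).prod (Measure.pi μ)) := by
    rw [← (measurePreserving_unzip μ μ).map_eq]
    refine (integrable_map_measure hH.aestronglyMeasurable
      (measurePreserving_unzip μ μ).measurable.aemeasurable).2 ?_
    have hI : Integrable (fun ω => (g (rd ∅ ω) - g (rd {i} ω)) ^ 2)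
        (Measure.pi fun i => (μ i).prod (μ i)) := ((hL ∅).sub (hL {i})).integrable_sq
    exact hI.congr (ae_of_all _ fun ω => hpt ω)
  rw [h1, integral_prod _ hint]
  refine integral_congr_ae (ae_of_all _ fun x => ?_)
  have hφ : AEStronglyMeasurable (fun y => (g x - g (Function.update x i y)) ^ 2) (μ i) :=
    (((hgm.comp (measurable_update x)).const_sub (g x)).pow_const 2).aestronglyMeasurable
  exact integral_comp_eq (measurePreserving_eval μ i) hφ

/-- The Efron–Stein inequality in terms of the doubled-space bookkeeping maps `rd`, `fl`.
[cite: BoucheronBousquetLugosi2004, §2 Thm 5] -/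
theorem variance_le [Fintype ι] [DecidableEq ι] [∀ i, MeasurableSpace (Ω i)]
    (μ : ∀ i, Measure (Ω i)) [∀ i, IsProbabilityMeasure (μ i)]
    {rd : Finset ι → (∀ i, Ω i × Ω i) → ∀ i, Ω i}
    {fl : Finset ι → (∀ i, Ω i × Ω i) → ∀ i, Ω i × Ω i}
    (hrd : ∀ S ω j, rd S ω j = if j ∈ S then (ω j).2 else (ω j).1)
    (hfl : ∀ S ω j, fl S ω j = if j ∈ S then (ω j).swap else ω j)
    {g : (∀ i, Ω i) → ℝ} (hgm : Measurable g) (hg : MemLp g 2 (Measure.pi μ)) :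
    variance g (Measure.pi μ) ≤
      (1 / 2 : ℝ) * ∑ i, ∫ x, (∫ y, (g x - g (Function.update x i y)) ^ 2 ∂μ i) ∂Measure.pi μ := by
  calc variance g (Measure.pi μ) = _ := variance_eq_integral μ hrd hfl hgm hg
    _ ≤ _ := integral_le_sum μ hrd hfl hgm hg Finset.univ
    _ = (1 / 2 : ℝ) * ∑ i, ∫ x, (∫ y, (g x - g (Function.update x i y)) ^ 2 ∂μ i) ∂Measure.pi μ := by
      congr 1
      exact Finset.sum_congr rfl fun i _ => integral_sq_sub_eq μ hrd hfl hgm hg i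

end EfronStein

/-- **Discharge of the named fact `EfronSteinInequality`** (Efron–Stein 1981; Steele 1986; as
printed in Boucheron–Bousquet–Lugosi 2004, §2 Theorem 5, proved there from the martingale
variance bound Theorem 4): `Var(Z) ≤ ½ Σᵢ E[(Z − Zᵢ')²]`. The proof follows the printed
architecture (decomposition of the variance along a chain of coordinates, then a one-coordinate
resampling bound), realised on the doubled product space by measure-preserving coordinate
swaps; see the module docstring. [cite: BoucheronBousquetLugosi2004, §2 Thm 5] -/
theorem EfronSteinInequality_holds : EfronSteinInequality :=
  fun _ι _ _ _Ω _ μ _ _g hgm hg =>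
    EfronStein.variance_le μ (rd := fun S ω j => if j ∈ S then (ω j).2 else (ω j).1)
      (fl := fun S ω j => if j ∈ S then (ω j).swap else ω j) (fun _ _ _ => rfl) (fun _ _ _ => rfl)
      hgm hg

end Literature.Probability.Moments
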